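import Summits.CriticalPhenomena.PercolationContinuityZ3.Theorems.PercNearOneGluingNoHeavyLowerTailCILUnionExchange
import HarnessLib

/-!
# `NoHeavyLowerTail` (stmt-CriticalPhenomena-4575) — the union exchange WITH an avoided vertex
# splits into two single-world covariance inequalities

Prover `prim-gen-induct` (gen 8), `--supports stmt-CriticalPhenomena-4575`.  No definitions, no named facts,
no sorries; standard axioms.

Setting (BLOBQUOTIENT.md §25–27 of the prover's notes): bond percolation `μ = prodBernoulli w` on a finite
vertex type, an observer `o`, two terminals `a₁ ≠ a₂` ("`W`"), an AVOIDED vertex `a`, `U = {o ↔ a₁} ∪ {o ↔ a₂}`,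
`M = {a₁ ↔ a₂}`, `Rᵢ = {aᵢ ↮ a}`, `D = {o ↮ a}`, and an arbitrary upper family `𝒜` of edge sets read on the
open edge clusters.  The anchor-gate line of the crux (RHLA for `|B| = 3`) needs the avoided-vertex union
exchange ("DOM2"): the law of `C_o` given `o ↔ W, o ↮ a` dominates a mixture of the laws of `C_{aᵢ}` given
`aᵢ ↮ a`, i.e. `Λ₁ μ(R₁ ∩ {C_{a₁} ∈ 𝒜}) + Λ₂ μ(R₂ ∩ {C_{a₂} ∈ 𝒜}) ≤ μ(U ∩ D ∩ {C_o ∈ 𝒜})` with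
`Λ₁ μ(R₁) + Λ₂ μ(R₂) = μ(U ∩ D)`.  The a-free case is the tree's `UnionExchange.pair_clusterDominance`
(`…CILUnionExchange`) and `pair_clusterDominance_endpoint`.

This file proves the bookkeeping half of the prover's "(S^θ) decomposition": for any real `θ`, DOM2 at the
weight `Λ₁(θ) μ(R₁) = μ(R₁ ∩ {o ↔ a₁} ∩ Mᶜ) + θ μ(R₁ ∩ {o ↔ a₁} ∩ M)`,
`Λ₂(θ) μ(R₂) = μ(R₂ ∩ {o ↔ a₂} ∩ Mᶜ) + (1 − θ) μ(R₂ ∩ {o ↔ a₂} ∩ M)` FOLLOWS from the two single-world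
covariance inequalities
`(S₁^θ)  μ(R₁) · [μ(R₁ ∩ A₁ ∩ O₁ ∩ Mᶜ) + θ μ(R₁ ∩ A₁ ∩ O₁ ∩ M)] ≥ μ(R₁ ∩ A₁) · [μ(R₁ ∩ O₁ ∩ Mᶜ) + θ μ(R₁ ∩ O₁ ∩ M)]`
(i.e. `Cov(𝒜, 1{o ∈ C, a₂ ∉ C} + θ · 1{o ∈ C, a₂ ∈ C}) ≥ 0` for the cluster `C = C_{a₁}` in the world
`a₁ ↮ a`) and its mirror image `(S₂^{1−θ})`.  The content is the exact three-way partition of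
`U ∩ D ∩ {C_o ∈ 𝒜}` by which terminal `o` hangs on and whether the terminals are merged; on the merged piece
the two clusters coincide, which is where `θ` and `1 − θ` recombine.  Numerically (loc. cit. §27) both
single-world inequalities hold at `θ = μ(o ↔ a₁ | o ↔ W, a₁, a₂, a pairwise separated)` (0 violations on
125 400 structured instances); they are the open part.

* `UnionExchange.pair_avoided_dominance_of_split` — the reduction, denominator-free.
-/

noncomputable section

open MeasureTheory Set
open Literature.Probability.LatticeModels (prodBernoulli)
open Literature.Probability.Percolation

namespace Summit.CriticalPhenomena.PercolationContinuityZ3.Theorems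

namespace UnionExchange

variable {V : Type*} [Fintype V]

/-- **DOM2 with an avoided vertex from two single-world covariance inequalities (the `(S^θ)` split).**
With `Oᵢ = {o ↔ aᵢ}`, `M = {a₁ ↔ a₂}`, `Rᵢ = {aᵢ ↮ a}`, `D = {o ↮ a}`, `Aᵥ = {C_v ∈ 𝒜}` for an upper family
`𝒜`, and any real `θ`: if
`μ(R₁ ∩ A₁) (μ(R₁ ∩ O₁ ∩ Mᶜ) + θ μ(R₁ ∩ O₁ ∩ M)) ≤ μ(R₁) (μ(R₁ ∩ A₁ ∩ O₁ ∩ Mᶜ) + θ μ(R₁ ∩ A₁ ∩ O₁ ∩ M))` and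
`μ(R₂ ∩ A₂) (μ(R₂ ∩ O₂ ∩ Mᶜ) + (1−θ) μ(R₂ ∩ O₂ ∩ M)) ≤ μ(R₂) (μ(R₂ ∩ A₂ ∩ O₂ ∩ Mᶜ) + (1−θ) μ(R₂ ∩ A₂ ∩ O₂ ∩ M))`,
then `μ(R₂) (μ(R₁ ∩ O₁ ∩ Mᶜ) + θ μ(R₁ ∩ O₁ ∩ M)) μ(R₁ ∩ A₁) + μ(R₁) (μ(R₂ ∩ O₂ ∩ Mᶜ) + (1−θ) μ(R₂ ∩ O₂ ∩ M)) μ(R₂ ∩ A₂)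
 ≤ μ(R₁) μ(R₂) μ((O₁ ∪ O₂) ∩ D ∩ A_o)`.
Proof: `U ∩ D ∩ A_o` is the disjoint union of `R₁ ∩ A₁ ∩ O₁ ∩ Mᶜ`, `R₂ ∩ A₂ ∩ O₂ ∩ Mᶜ` and
`R₁ ∩ A₁ ∩ O₁ ∩ M = R₂ ∩ A₂ ∩ O₂ ∩ M` (on `Oᵢ` the clusters of `o` and `aᵢ` coincide). -/
theorem pair_avoided_dominance_of_split (w : Sym2 V → unitInterval) (o a₁ a₂ a : V) (θ : ℝ)
    {𝒜 : Set (Set (Sym2 V))}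
    (hS₁ : (prodBernoulli w).real ({ω : BondConfig V | ¬ (openGraph ω).Reachable a₁ a} ∩
          {ω | openEdgeCluster ω a₁ ∈ 𝒜}) *
        ((prodBernoulli w).real ({ω : BondConfig V | ¬ (openGraph ω).Reachable a₁ a} ∩ openConn o a₁ ∩
            {ω | ¬ (openGraph ω).Reachable a₁ a₂}) +
          θ * (prodBernoulli w).real ({ω : BondConfig V | ¬ (openGraph ω).Reachable a₁ a} ∩ openConn o a₁ ∩
            openConn a₁ a₂)) ≤
      (prodBernoulli w).real {ω : BondConfig V | ¬ (openGraph ω).Reachable a₁ a} *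
        ((prodBernoulli w).real ({ω : BondConfig V | ¬ (openGraph ω).Reachable a₁ a} ∩
            {ω | openEdgeCluster ω a₁ ∈ 𝒜} ∩ openConn o a₁ ∩ {ω | ¬ (openGraph ω).Reachable a₁ a₂}) +
          θ * (prodBernoulli w).real ({ω : BondConfig V | ¬ (openGraph ω).Reachable a₁ a} ∩
            {ω | openEdgeCluster ω a₁ ∈ 𝒜} ∩ openConn o a₁ ∩ openConn a₁ a₂)))
    (hS₂ : (prodBernoulli w).real ({ω : BondConfig V | ¬ (openGraph ω).Reachable a₂ a} ∩
          {ω | openEdgeCluster ω a₂ ∈ 𝒜}) *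
        ((prodBernoulli w).real ({ω : BondConfig V | ¬ (openGraph ω).Reachable a₂ a} ∩ openConn o a₂ ∩
            {ω | ¬ (openGraph ω).Reachable a₁ a₂}) +
          (1 - θ) * (prodBernoulli w).real ({ω : BondConfig V | ¬ (openGraph ω).Reachable a₂ a} ∩
            openConn o a₂ ∩ openConn a₁ a₂)) ≤
      (prodBernoulli w).real {ω : BondConfig V | ¬ (openGraph ω).Reachable a₂ a} *
        ((prodBernoulli w).real ({ω : BondConfig V | ¬ (openGraph ω).Reachable a₂ a} ∩
            {ω | openEdgeCluster ω a₂ ∈ 𝒜} ∩ openConn o a₂ ∩ {ω | ¬ (openGraph ω).Reachable a₁ a₂}) +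
          (1 - θ) * (prodBernoulli w).real ({ω : BondConfig V | ¬ (openGraph ω).Reachable a₂ a} ∩
            {ω | openEdgeCluster ω a₂ ∈ 𝒜} ∩ openConn o a₂ ∩ openConn a₁ a₂))) :
    (prodBernoulli w).real {ω : BondConfig V | ¬ (openGraph ω).Reachable a₂ a} *
        ((prodBernoulli w).real ({ω : BondConfig V | ¬ (openGraph ω).Reachable a₁ a} ∩ openConn o a₁ ∩
            {ω | ¬ (openGraph ω).Reachable a₁ a₂}) +
          θ * (prodBernoulli w).real ({ω : BondConfig V | ¬ (openGraph ω).Reachable a₁ a} ∩ openConn o a₁ ∩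
            openConn a₁ a₂)) *
        (prodBernoulli w).real ({ω : BondConfig V | ¬ (openGraph ω).Reachable a₁ a} ∩
          {ω | openEdgeCluster ω a₁ ∈ 𝒜}) +
      (prodBernoulli w).real {ω : BondConfig V | ¬ (openGraph ω).Reachable a₁ a} *
        ((prodBernoulli w).real ({ω : BondConfig V | ¬ (openGraph ω).Reachable a₂ a} ∩ openConn o a₂ ∩
            {ω | ¬ (openGraph ω).Reachable a₁ a₂}) +
          (1 - θ) * (prodBernoulli w).real ({ω : BondConfig V | ¬ (openGraph ω).Reachable a₂ a} ∩
            openConn o a₂ ∩ openConn a₁ a₂)) *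
        (prodBernoulli w).real ({ω : BondConfig V | ¬ (openGraph ω).Reachable a₂ a} ∩
          {ω | openEdgeCluster ω a₂ ∈ 𝒜}) ≤
    (prodBernoulli w).real {ω : BondConfig V | ¬ (openGraph ω).Reachable a₁ a} *
      (prodBernoulli w).real {ω : BondConfig V | ¬ (openGraph ω).Reachable a₂ a} *
      (prodBernoulli w).real ((openConn o a₁ ∪ openConn o a₂) ∩
        {ω : BondConfig V | ¬ (openGraph ω).Reachable o a} ∩ {ω | openEdgeCluster ω o ∈ 𝒜}) := by
  classical
  set μ := prodBernoulli w with hμ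
  set O₁ : Set (BondConfig V) := openConn o a₁ with hO₁
  set O₂ : Set (BondConfig V) := openConn o a₂ with hO₂
  set Mr : Set (BondConfig V) := openConn a₁ a₂ with hMr
  set Mc : Set (BondConfig V) := {ω | ¬ (openGraph ω).Reachable a₁ a₂} with hMc
  set R₁ : Set (BondConfig V) := {ω | ¬ (openGraph ω).Reachable a₁ a} with hR₁
  set R₂ : Set (BondConfig V) := {ω | ¬ (openGraph ω).Reachable a₂ a} with hR₂
  set Dx : Set (BondConfig V) := {ω | ¬ (openGraph ω).Reachable o a} with hDx
  set A₀ : Set (BondConfig V) := {ω | openEdgeCluster ω o ∈ 𝒜} with hA₀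
  set A₁ : Set (BondConfig V) := {ω | openEdgeCluster ω a₁ ∈ 𝒜} with hA₁
  set A₂ : Set (BondConfig V) := {ω | openEdgeCluster ω a₂ ∈ 𝒜} with hA₂
  -- the three pieces
  set P₁ : Set (BondConfig V) := R₁ ∩ A₁ ∩ O₁ ∩ Mc with hP₁
  set P₂ : Set (BondConfig V) := R₂ ∩ A₂ ∩ O₂ ∩ Mc with hP₂
  set J₁ : Set (BondConfig V) := R₁ ∩ A₁ ∩ O₁ ∩ Mr with hJ₁
  set J₂ : Set (BondConfig V) := R₂ ∩ A₂ ∩ O₂ ∩ Mr with hJ₂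
  -- on the merged piece the two descriptions agree
  have hJ : J₁ = J₂ := by
    ext ω
    simp only [hJ₁, hJ₂, hR₁, hR₂, hA₁, hA₂, hO₁, hO₂, hMr, openConn, mem_inter_iff, mem_setOf_eq]
    constructor
    · rintro ⟨⟨⟨hr1, hA⟩, ho1⟩, hm⟩
      refine ⟨⟨⟨fun h => hr1 (hm.trans h), ?_⟩, ho1.trans hm⟩, hm⟩
      rw [openEdgeCluster_eq_of_reachable hm]; exact hA
    · rintro ⟨⟨⟨hr2, hA⟩, ho2⟩, hm⟩
      refine ⟨⟨⟨fun h => hr2 (hm.symm.trans h), ?_⟩, ho2.trans hm.symm⟩, hm⟩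
      rw [← openEdgeCluster_eq_of_reachable hm]; exact hA
  -- the partition of `U ∩ D ∩ A₀`
  have hE : (O₁ ∪ O₂) ∩ Dx ∩ A₀ = (P₁ ∪ J₁) ∪ P₂ := by
    ext ω
    simp only [hP₁, hP₂, hJ₁, hR₁, hR₂, hA₀, hA₁, hA₂, hO₁, hO₂, hMr, hMc, hDx, openConn,
      mem_inter_iff, mem_union, mem_setOf_eq]
    constructor
    · rintro ⟨⟨h1 | h2, hd⟩, hA⟩
      · have hr1 : ¬ (openGraph ω).Reachable a₁ a := fun h => hd (h1.trans h)
        have hA1 : openEdgeCluster ω a₁ ∈ 𝒜 := by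
          rw [openEdgeCluster_eq_of_reachable h1]; exact hA
        by_cases hm : (openGraph ω).Reachable a₁ a₂
        · exact Or.inl (Or.inr ⟨⟨⟨hr1, hA1⟩, h1⟩, hm⟩)
        · exact Or.inl (Or.inl ⟨⟨⟨hr1, hA1⟩, h1⟩, hm⟩)
      · by_cases h1 : (openGraph ω).Reachable o a₁
        · have hr1 : ¬ (openGraph ω).Reachable a₁ a := fun h => hd (h1.trans h)
          have hA1 : openEdgeCluster ω a₁ ∈ 𝒜 := by
            rw [openEdgeCluster_eq_of_reachable h1]; exact hA
          have hm : (openGraph ω).Reachable a₁ a₂ := h1.symm.trans h2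
          exact Or.inl (Or.inr ⟨⟨⟨hr1, hA1⟩, h1⟩, hm⟩)
        · have hr2 : ¬ (openGraph ω).Reachable a₂ a := fun h => hd (h2.trans h)
          have hA2 : openEdgeCluster ω a₂ ∈ 𝒜 := by
            rw [openEdgeCluster_eq_of_reachable h2]; exact hA
          have hm : ¬ (openGraph ω).Reachable a₁ a₂ := fun h => h1 (h2.trans h.symm)
          exact Or.inr ⟨⟨⟨hr2, hA2⟩, h2⟩, hm⟩
    · rintro ((⟨⟨⟨hr1, hA1⟩, h1⟩, _⟩ | ⟨⟨⟨hr1, hA1⟩, h1⟩, _⟩) | ⟨⟨⟨hr2, hA2⟩, h2⟩, _⟩)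
      · exact ⟨⟨Or.inl h1, fun h => hr1 (h1.symm.trans h)⟩, by
          rw [← openEdgeCluster_eq_of_reachable h1]; exact hA1⟩
      · exact ⟨⟨Or.inl h1, fun h => hr1 (h1.symm.trans h)⟩, by
          rw [← openEdgeCluster_eq_of_reachable h1]; exact hA1⟩
      · exact ⟨⟨Or.inr h2, fun h => hr2 (h2.symm.trans h)⟩, by
          rw [← openEdgeCluster_eq_of_reachable h2]; exact hA2⟩
  have hdisj1 : Disjoint P₁ J₁ := by
    rw [Set.disjoint_left]
    rintro ω ⟨_, hm⟩ ⟨_, hm'⟩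
    exact hm hm'
  have hdisj2 : Disjoint (P₁ ∪ J₁) P₂ := by
    rw [Set.disjoint_left]
    rintro ω (⟨⟨⟨_, _⟩, h1⟩, hm⟩ | ⟨⟨⟨_, _⟩, h1⟩, hm⟩) ⟨⟨⟨_, _⟩, h2⟩, hm2⟩
    · exact hm (h1.symm.trans h2)
    · exact hm2 hm
  have hmE : μ.real ((O₁ ∪ O₂) ∩ Dx ∩ A₀) = μ.real P₁ + μ.real J₁ + μ.real P₂ := by
    rw [hE, measureReal_union hdisj2 MeasurableSet.of_discrete,
      measureReal_union hdisj1 MeasurableSet.of_discrete]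
  -- combine (the `set`s have already rewritten the hypotheses in terms of the pieces)
  rw [← hJ] at hS₂
  rw [hmE]
  have hR1nn : 0 ≤ μ.real R₁ := measureReal_nonneg
  have hR2nn : 0 ≤ μ.real R₂ := measureReal_nonneg
  have h1 := mul_le_mul_of_nonneg_left hS₁ hR2nn
  have h2 := mul_le_mul_of_nonneg_left hS₂ hR1nn
  nlinarith [h1, h2]


open Literature.Probability.Percolation.KNPreFKG in
/-- **The single-world split without an avoided vertex is a theorem.**  With `O₁ = {o ↔ a₁}`,
`O₂ = {o ↔ a₂}`, `Mᶜ = {a₁ ↮ a₂}`, `A₁ = {C_{a₁} ∈ 𝒜}` (`𝒜` an upper family):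
`0 ≤ μ(O₁ ∩ Mᶜ) · [μ(A₁ ∩ O₁) − μ(A₁) μ(O₁)] + μ(O₂ ∩ Mᶜ) · [μ(A₁ ∩ O₁ ∩ Mᶜ) − μ(A₁) μ(O₁ ∩ Mᶜ)]`,
i.e. `τ₁ · Cov(𝒜, o ∈ C) + τ₂ · Cov(𝒜, {o ∈ C, a₂ ∉ C}) ≥ 0` for `C = C_{a₁}`, `τᵢ = μ(o ↔ aᵢ | a₁ ↮ a₂)` — the
hypothesis `(S₁^θ)` of `pair_avoided_dominance_of_split` at `θ = τ₁/(τ₁+τ₂)` when there is no avoided vertex.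
Proof (three lines): Harris for `A₁` and `U = O₁ ∪ O₂`; then
`μ(O₂ ∩ Mᶜ) μ(A₁ ∩ O₁ ∩ Mᶜ) ≥ μ(O₁ ∩ Mᶜ) μ(A₁ ∩ O₂ ∩ Mᶜ)`, which is BHK Thm 1.3 (positive association of
`C_{a₁}` given `a₁ ↮ a₂`) times BHK Thm 1.4 (negative correlation of `C_{a₁}`, `C_{a₂}` given `a₁ ↮ a₂`). -/
theorem pair_split_afree (w : Sym2 V → unitInterval) (o a₁ a₂ : V) (h12 : a₁ ≠ a₂)
    {𝒜 : Set (Set (Sym2 V))} (h𝒜 : IsUpperSet 𝒜) :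
    0 ≤ (prodBernoulli w).real (openConn o a₁ ∩ {ω : BondConfig V | ¬ (openGraph ω).Reachable a₁ a₂}) *
        ((prodBernoulli w).real ({ω : BondConfig V | openEdgeCluster ω a₁ ∈ 𝒜} ∩ openConn o a₁) -
          (prodBernoulli w).real {ω : BondConfig V | openEdgeCluster ω a₁ ∈ 𝒜} *
            (prodBernoulli w).real (openConn o a₁ : Set (BondConfig V))) +
      (prodBernoulli w).real (openConn o a₂ ∩ {ω : BondConfig V | ¬ (openGraph ω).Reachable a₁ a₂}) *
        ((prodBernoulli w).real ({ω : BondConfig V | openEdgeCluster ω a₁ ∈ 𝒜} ∩ openConn o a₁ ∩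
            {ω : BondConfig V | ¬ (openGraph ω).Reachable a₁ a₂}) -
          (prodBernoulli w).real {ω : BondConfig V | openEdgeCluster ω a₁ ∈ 𝒜} *
            (prodBernoulli w).real (openConn o a₁ ∩ {ω : BondConfig V | ¬ (openGraph ω).Reachable a₁ a₂})) := by
  classical
  set μ := prodBernoulli w with hμ
  set O₁ : Set (BondConfig V) := openConn o a₁ with hO₁
  set O₂ : Set (BondConfig V) := openConn o a₂ with hO₂
  set Mc : Set (BondConfig V) := {ω | ¬ (openGraph ω).Reachable a₁ a₂} with hMc
  set A₁ : Set (BondConfig V) := {ω | openEdgeCluster ω a₁ ∈ 𝒜} with hA₁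
  -- `U = O₁ ⊔ (O₂ ∩ Mᶜ)`
  have hU : O₁ ∪ O₂ = O₁ ∪ (O₂ ∩ Mc) := by
    ext ω
    simp only [hO₁, hO₂, hMc, openConn, mem_union, mem_inter_iff, mem_setOf_eq]
    constructor
    · rintro (h1 | h2)
      · exact Or.inl h1
      · by_cases h1 : (openGraph ω).Reachable o a₁
        · exact Or.inl h1
        · exact Or.inr ⟨h2, fun h => h1 (h2.trans h.symm)⟩
    · rintro (h1 | ⟨h2, _⟩)
      · exact Or.inl h1
      · exact Or.inr h2
  have hdU : Disjoint O₁ (O₂ ∩ Mc) := by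
    rw [Set.disjoint_left]
    rintro ω h1 ⟨h2, hm⟩
    exact hm ((show (openGraph ω).Reachable o a₁ from h1).symm.trans h2)
  have hAU : A₁ ∩ (O₁ ∪ O₂) = (A₁ ∩ O₁) ∪ (A₁ ∩ O₂ ∩ Mc) := by
    rw [hU, inter_union_distrib_left, inter_assoc]
  have hdAU : Disjoint (A₁ ∩ O₁) (A₁ ∩ O₂ ∩ Mc) := by
    rw [Set.disjoint_left]
    rintro ω ⟨_, h1⟩ ⟨⟨_, h2⟩, hm⟩
    exact hm ((show (openGraph ω).Reachable o a₁ from h1).symm.trans h2)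
  have hmU : μ.real (O₁ ∪ O₂) = μ.real O₁ + μ.real (O₂ ∩ Mc) := by
    rw [hU, measureReal_union hdU MeasurableSet.of_discrete]
  have hmAU : μ.real (A₁ ∩ (O₁ ∪ O₂)) = μ.real (A₁ ∩ O₁) + μ.real (A₁ ∩ O₂ ∩ Mc) := by
    rw [hAU, measureReal_union hdAU MeasurableSet.of_discrete]
  -- Harris for `A₁` and `U`
  have hUup : IsUpperSet (O₁ ∪ O₂ : Set (BondConfig V)) :=
    (isUpperSet_openConn o a₁).union (isUpperSet_openConn o a₂)
  have hH := Literature.Probability.LatticeModels.prodBernoulli_harris w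
    (isUpperSet_setOf_openEdgeCluster_mem a₁ h𝒜) hUup MeasurableSet.of_discrete MeasurableSet.of_discrete
  simp only [← hμ, ← hA₁] at hH
  rw [hmU, hmAU] at hH
  -- BHK Thm 1.3 (given `a₁ ↮ a₂`): `μ(Mᶜ ∩ A₁) μ(Mᶜ ∩ O₁) ≤ μ(Mᶜ) μ(Mᶜ ∩ (A₁ ∩ O₁))`
  have hD : {ω : BondConfig V | ∀ x ∈ ({a₂} : Set V), ¬ (openGraph ω).Reachable a₁ x} = Mc := by
    ext ω
    simp only [mem_setOf_eq, mem_singleton_iff, forall_eq, hMc]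
  have h_i := bhk_one_upper_upper w a₁ ({a₂} : Set V) (by simpa using h12) h𝒜 (isUpperSet_connFamily a₁ o)
  rw [hD, ← openConn_eq_setOf_connFamily, openConn_symm a₁ o] at h_i
  -- BHK Thm 1.4: `μ(Mᶜ) μ(Mᶜ ∩ (A₁ ∩ O₂)) ≤ μ(Mᶜ ∩ A₁) μ(Mᶜ ∩ O₂)`
  have h_ii := bhk_two_upper_upper w a₁ a₂ h12 h𝒜 (isUpperSet_connFamily a₂ o)
  rw [← openConn_eq_setOf_connFamily, openConn_symm a₂ o] at h_ii
  simp only [← hμ, ← hO₁, ← hO₂, ← hA₁, ← hMc] at h_i h_ii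
  -- normalise intersections
  have e1 : Mc ∩ (A₁ ∩ O₁) = A₁ ∩ O₁ ∩ Mc := by rw [inter_comm, inter_assoc]
  have e2 : Mc ∩ O₁ = O₁ ∩ Mc := inter_comm _ _
  have e3 : Mc ∩ (A₁ ∩ O₂) = A₁ ∩ O₂ ∩ Mc := by rw [inter_comm, inter_assoc]
  have e4 : Mc ∩ O₂ = O₂ ∩ Mc := inter_comm _ _
  rw [e1, e2] at h_i
  rw [e3, e4] at h_ii
  -- the bracket `B = μ(O₂ ∩ Mᶜ) μ(A₁ ∩ O₁ ∩ Mᶜ) − μ(O₁ ∩ Mᶜ) μ(A₁ ∩ O₂ ∩ Mᶜ)` is nonnegative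
  have hB : 0 ≤ μ.real (O₂ ∩ Mc) * μ.real (A₁ ∩ O₁ ∩ Mc) - μ.real (O₁ ∩ Mc) * μ.real (A₁ ∩ O₂ ∩ Mc) := by
    by_cases h0 : μ.real Mc = 0
    · have z1 : μ.real (O₁ ∩ Mc) = 0 := measureReal_mono_null inter_subset_right h0
      have z2 : μ.real (O₂ ∩ Mc) = 0 := measureReal_mono_null inter_subset_right h0
      rw [z1, z2]; simp
    · have hpos : 0 < μ.real Mc := lt_of_le_of_ne measureReal_nonneg (Ne.symm h0)
      have hO2nn : 0 ≤ μ.real (O₂ ∩ Mc) := measureReal_nonneg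
      have hO1nn : 0 ≤ μ.real (O₁ ∩ Mc) := measureReal_nonneg
      have k1 := mul_le_mul_of_nonneg_left h_i hO2nn
      have k2 := mul_le_mul_of_nonneg_left h_ii hO1nn
      have hprod : μ.real Mc * 0 ≤ μ.real Mc *
          (μ.real (O₂ ∩ Mc) * μ.real (A₁ ∩ O₁ ∩ Mc) - μ.real (O₁ ∩ Mc) * μ.real (A₁ ∩ O₂ ∩ Mc)) := by
        nlinarith [k1, k2]
      exact le_of_mul_le_mul_left hprod hpos
  nlinarith [hH, hB, measureReal_nonneg (μ := μ) (s := O₁ ∩ Mc), measureReal_nonneg (μ := μ) (s := O₂ ∩ Mc)]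

end UnionExchange

end Summit.CriticalPhenomena.PercolationContinuityZ3.Theorems
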